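import Literature.MathematicalPhysics.KineticTheory.ShortRangePotentials
import HarnessLib

/-!
# A tagged hard sphere at equilibrium: the printed architecture of the Brownian limit
(Bodineau–Gallagher–Saint-Raymond, Invent. Math. 203 (2016); arXiv:1305.3397v2 numbering)

The named fact `Literature.MathematicalPhysics.KineticTheory.bodineau_gallagher_saintRaymond_brownian`
(`Literature/MathematicalPhysics/KineticTheory/ShortRangePotentials.lean`, item (d)) renders
BGSR's Theorem 2.3 (the diffusive limit of a tagged hard sphere in a gas at equilibrium on the
fixed torus `T^d`) at the level of one-time position marginals. Its proof in print is a whole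
theory (Lanford's strategy pushed to times diverging with `N`, pruning of super-exponential
collision trees, plus the hydrodynamic limit of the linear Boltzmann equation), so this file
DECOMPOSES it into the intermediate results *as printed*, each vendored as a named fact with
its locator, and records the one point where the vendored statement (d) over-reaches the source.

## What is printed (arXiv:1305.3397v2)

* **Thm 2.2** (p. 7, (2.9)): with `f_N^0 = M_{N,β} ρ⁰(x₁)` (2.8), for all `t > 0`, `α > 1`, in
  the limit `N → ∞`, `N ε^{d-1} α⁻¹ = 1`,
  `‖f_N^{(1)}(t) - M_β φ_α(t)‖_{L^∞(T^d × ℝ^d)} ≤ C [tα / (log log N)^{(A-1)/A}]^{A²/(A-1)}`,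
  `A ≥ 2` arbitrary, `C = C(A, β, d, ‖ρ⁰‖_∞)`, where `φ_α` solves the linear Boltzmann equation
  `∂ₜ φ + v·∇ₓ φ = -α L φ` (1.3) with hard-sphere cross-section and `φ(0) = ρ⁰`
  (`bgsr_linearBoltzmannApprox`).
* **§6.1.1** (p. 30, (6.1)): at `t = ατ` the bound reads
  `C [α² τ / (log log N)^{(A-1)/A}]^{A²/(A-1)}`, and "it is therefore possible to take the limit
  `α → ∞` while conserving a small right-hand side in (6.1), as soon as
  `α ≪ (log log N)^{(A-1)/(2A)}`" — this is the precise growth restriction behind Thm 2.3's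
  informal "`α` going to infinity much slower than `√(log log N)`".
* **Lemma 6.1, (6.5), (6.8)** (pp. 31–32): `L` is Fredholm on `L²(a_β M_β dv)` with kernel the
  constants, so there is a unique centred `b` with `L b = v` (`IsDiffusionCorrector`,
  `bgsr_exists_diffusionCorrector`), and `κ_β := d⁻¹ ∫ v·L⁻¹v M_β dv = d⁻¹ ∫ v·b(v) M_β(v) dv`
  (`bgsrDiffusionCoeff`; positivity `bgsr_diffusionCoeff_pos`).
* **(6.3)** (p. 31, proved in §6.1.3 by a Hilbert expansion and the maximum principle):
  `sup_{τ ∈ [0,T]} sup_{x,v} M_β(v) |φ_α(ατ, x, v) - ρ(τ, x)| → 0` as `α → ∞`, `ρ` the solution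
  of the heat equation `∂_τ ρ = κ_β Δ ρ`, `ρ(0) = ρ⁰` on `T^d` (2.11) (`bgsr_hydrodynamicLimit`,
  with `ρ` written as the wrapped-Gaussian average `torusHeatSolution`).
* **Thm 2.3 = (6.1) + (6.3)** (p. 8, (2.12)); the one-time position-marginal form then follows
  by Scheffé's lemma (both sides are probability densities) — this assembly is ordinary measure
  theory and is the object of the sibling `…Proofs` file (in progress, see the folder NOTES).

## The discrepancy recorded here

`bodineau_gallagher_saintRaymond_brownian` types the growth restriction as the little-o
condition `α_k / √(log log N_k) → 0`. The printed proof (Thm 2.2 with `C` depending on `A`,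
and §6.1.1) only covers sequences with `α_k / (log log N_k)^{(A-1)/(2A)} → 0` for SOME fixed
`A ≥ 2`; e.g. `α_k = √(log log N_k) / log log log N_k` satisfies the former but no printed
estimate covers it. The corrected statement `bodineau_gallagher_saintRaymond_diffusive` below is
(d) verbatim with this hypothesis (and the paper's total particle number `N_k + 1` inside the
iterated logarithm); it is implied by (d) and is what Thm 2.2 + (6.3) assemble to.

## Design choices

* `f_N^{(1)}(t)` is `bgsrTaggedMarginal`: the first marginal (`Kinetic.nthMarginal … 1`, which
  keeps particle `0`, the tagged one) of the initial density (2.8) transported along the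
  hard-sphere flow on its good set, `Φ.good.indicator (Kinetic.hsTransport Φ t f⁰)`, exactly as
  in `Hilbert6.HardSphereBBGKY`; the `L^∞` norms of the paper are essential suprema
  (`eLpNorm · ∞ volume`), insensitive to the version chosen.
* The linear Boltzmann equation (1.3) for `φ` is expressed on `g = M_β φ` through the accepted
  `Kinetic.IsMildLinearBoltzmannSolutionOn T (Torus.geometry d) (α • hardSphereKernel)
  (Kinetic.maxwellianBeta β) g` (`M_β · (-α L φ) = α Q(M_β φ, M_β)` by
  `M_β(v') M_β(v₁') = M_β(v) M_β(v₁)`), in the bounded continuous class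
  (`IsTaggedLinearBoltzmannSolution`), which is a uniqueness class for this linear equation
  (maximum principle, BGSR (4.2)); Thm 2.2 is vendored with the solution existentially
  quantified ("`φ_α` is the solution"), (6.3) universally over that class.
* Thm 2.2 is vendored in the uniform form its proof yields and §6.1.1 uses (constants `C, N₀`
  depending on `d, β, A` and a bound `R ≥ ‖ρ⁰‖_∞` only; `t > 1` as in Prop. 4.3, `α > 1`).
* `κ_β` needs `L⁻¹ v`; instead of an operator-theoretic inverse we quantify over *correctors*
  `b` with `L b = v` a.e., `∫ b M_β = 0`, `b ∈ L²(a_β M_β)` (6.5), whose existence and uniqueness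
  is Lemma 6.1 (a separate named fact), so no choice is involved and nothing is vacuous.
* Everything lives in `namespace Literature.Hilbert6` next to items (c)–(d); `d ≥ 2` and `β > 0` are
  the paper's standing assumptions (§2.2).

## References

* T. Bodineau, I. Gallagher, L. Saint-Raymond, *The Brownian motion as the limit of a
  deterministic system of hard-spheres*, Invent. Math. 203 (2016) 493–553 = arXiv:1305.3397v2,
  Thm 2.2 (2.9), Thm 2.3 (2.11)–(2.12), §6.1 (6.1)–(6.10), Lemma 6.1.
* D. Hilbert, *Begründung der kinetischen Gastheorie*, Math. Ann. 72 (1912) (BGSR's [24], the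
  Fredholm property of `L`).
* A. Bensoussan, J.-L. Lions, G. Papanicolaou, *Boundary layers and homogenization of transport
  processes*, Publ. RIMS 15 (1979) (BGSR's [6], the diffusive limit of linear transport).
-/

open MeasureTheory Metric Set Filter Topology ProbabilityTheory
open scoped InnerProductSpace ENNReal

namespace Literature.MathematicalPhysics.KineticTheory

noncomputable section

variable {d : Type*} [Fintype d]

local notation "𝔼" => EuclideanSpace ℝ d
local notation "𝕋" => UnitAddTorus d

/-! ## The objects of BGSR §2.3 and §6.1 -/

/-- BGSR's initial datum (2.8), real-valued: `f_N^0(Z) = M_{N,β}(Z) ρ⁰(x₁)`, the hard-sphere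
Gibbs density `𝒵⁻¹ 1_{D_ε} M_β^{⊗(N+1)}` (`Kinetic.canonicalDensity` of the one-particle density
`(x, v) ↦ M_β(v)`) tilted by the position density `ρ⁰` of the tagged particle `0`. The accepted
`Kinetic.equilibriumTaggedDensity … β (ρ₀ ∘ Prod.fst)` is `ENNReal.ofReal` of this function
(`equilibriumTaggedDensity_eq`). [cite: BodineauGallagherSaintRaymondInvent2016, (2.8)] -/
def bgsrInitialDensity (ε : ℝ) (N : ℕ) (β : ℝ) (ρ₀ : 𝕋 → ℝ) :
    Literature.Analysis.FluidPDE.Config (N + 1) d 𝕋 → ℝ :=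
  fun z => Literature.Analysis.FluidPDE.canonicalDensity (Literature.Analysis.FluidPDE.Torus.geometry d) ε (N + 1)
    (fun p => Literature.Analysis.FunctionSpaces.maxwellianBeta β p.2) z * ρ₀ (z 0).1

/-- The accepted `ℝ≥0∞`-valued initial density of items (c)–(d) is `ENNReal.ofReal` of BGSR's
(2.8). [folklore] -/
theorem equilibriumTaggedDensity_eq (ε : ℝ) (N : ℕ) (β : ℝ) (ρ₀ : 𝕋 → ℝ) :
    Literature.Analysis.FunctionSpaces.equilibriumTaggedDensity (Literature.Analysis.FluidPDE.Torus.geometry d) ε N β (fun z => ρ₀ z.1) =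
      fun z => ENNReal.ofReal (bgsrInitialDensity ε N β ρ₀ z) :=
  rfl

/-- The distribution `f_N^{(1)}(t, x, v)` of the tagged particle (BGSR §3, the first marginal
`∫ f_N(t, Z_N) dz₂ ⋯ dz_N` of the solution of the Liouville equation started from (2.8)):
the first marginal (`Kinetic.nthMarginal … 1`, keeping particle `0`) of the initial density
transported along the hard-sphere flow on its good set (`Φ.good.indicator (hsTransport Φ t f⁰)`,
as in `Hilbert6.HardSphereBBGKY`; off the conull good set the prelude flow is junk). A version of
the density of `Kinetic.taggedLaw Φ (equilibriumTaggedDensity …) t`.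
[cite: BodineauGallagherSaintRaymondInvent2016, §3 (first marginal) and (2.10)] -/
def bgsrTaggedMarginal {ε : ℝ} {N : ℕ} (Φ : Literature.Analysis.FluidPDE.HardSphereFlow (Literature.Analysis.FluidPDE.Torus.geometry d) ε (N + 1))
    (β : ℝ) (ρ₀ : 𝕋 → ℝ) (t : ℝ) (x : 𝕋) (v : 𝔼) : ℝ :=
  Literature.Analysis.FluidPDE.nthMarginal (N + 1) 1
    (Φ.good.indicator (Literature.Analysis.FluidPDE.hsTransport Φ t (bgsrInitialDensity ε N β ρ₀))) fun _ => (x, v)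

/-- The linear Boltzmann operator of BGSR (1.3) (hard-sphere cross-section, background at
inverse temperature `β`), acting on functions of the velocity:
`(L φ)(v) = ∫_{ℝ^d} ∫_{S^{d-1}} ((v - v₁)·ν)₊ M_β(v₁) [φ(v) - φ(v')] dν dv₁`,
`v' = v - ((v - v₁)·ν) ν` (`Hilbert6.collide`). The equation for the tagged density is
`∂ₜ φ + v·∇ₓ φ = -α L φ`. Iterated Bochner integral against `Hilbert6.sphereMeasure`
(unnormalised) and Lebesgue measure; junk value `0` where not integrable.
[cite: BodineauGallagherSaintRaymondInvent2016, (1.3)] -/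
def linearBoltzmannOp (β : ℝ) (φ : 𝔼 → ℝ) (v : 𝔼) : ℝ :=
  ∫ v₁, ∫ ν, hardSphereKernel (v, v₁) ν * Literature.Analysis.FunctionSpaces.maxwellianBeta β v₁ *
    (φ v - φ (collide ν (v, v₁)).1) ∂sphereMeasure

/-- Constants are in the kernel of `L` (the integrand vanishes identically; half of the kernel
statement of BGSR Lemma 6.1). [cite: BodineauGallagherSaintRaymondInvent2016, Lemma 6.1] -/
@[simp]
theorem linearBoltzmannOp_const (β c : ℝ) : linearBoltzmannOp β (fun _ : 𝔼 => c) = 0 := by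
  funext v
  simp [linearBoltzmannOp]

/-- The collision frequency `a_β(v) = ∫∫ M_β(v₁) ((v - v₁)·ν)₊ dν dv₁` of BGSR §6.1.2 (so that
`L = a_β(v) Id - K` with `K` compact). [cite: BodineauGallagherSaintRaymondInvent2016, §6.1.2] -/
def TaggedSphereDiffusion.collisionFrequency (β : ℝ) (v : 𝔼) : ℝ :=
  ∫ v₁, ∫ ν, hardSphereKernel (v, v₁) ν * Literature.Analysis.FunctionSpaces.maxwellianBeta β v₁ ∂sphereMeasure

/-- `b : ℝ^d → ℝ^d` is a *diffusion corrector* at inverse temperature `β` (BGSR (6.5) with the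
functional setting of Lemma 6.1): `b` is measurable, lies in `L²(ℝ^d, a_β M_β dv)`, is centred
(`∫ b M_β dv = 0`) and solves `L b = v` componentwise (almost everywhere, the `L²` sense).
By Lemma 6.1 such a `b` exists and is unique a.e. (`bgsr_exists_diffusionCorrector`); by
rotational symmetry `b(v) = γ(|v|) v`. [cite: BodineauGallagherSaintRaymondInvent2016, (6.5)] -/
def IsDiffusionCorrector (β : ℝ) (b : 𝔼 → 𝔼) : Prop :=
  Measurable b ∧
    Integrable (fun v => ‖b v‖ ^ 2 * TaggedSphereDiffusion.collisionFrequency β v * Literature.Analysis.FunctionSpaces.maxwellianBeta β v) ∧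
    ∫ v, Literature.Analysis.FunctionSpaces.maxwellianBeta β v • b v = 0 ∧
    ∀ᵐ v : 𝔼, ∀ i : d, linearBoltzmannOp β (fun w => b w i) v = v i

/-- BGSR's diffusion coefficient (6.8) computed from a corrector `b = L⁻¹ v`:
`κ_β = d⁻¹ ∫ v · L⁻¹v M_β(v) dv = d⁻¹ ∫ v · b(v) M_β(v) dv`.
[cite: BodineauGallagherSaintRaymondInvent2016, (6.8)] -/
def bgsrDiffusionCoeff (β : ℝ) (b : 𝔼 → 𝔼) : ℝ :=
  (Fintype.card d : ℝ)⁻¹ * ∫ v, ⟪v, b v⟫_ℝ * Literature.Analysis.FunctionSpaces.maxwellianBeta β v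

/-- The solution of the heat equation `∂_τ ρ = κ Δ ρ`, `ρ(0) = ρ⁰` on the flat torus
(BGSR (2.11)), written as the convolution of `ρ⁰` with the wrapped heat kernel (the wrapped
Gaussian of covariance `2κτ · Id`): `ρ(τ, x) = (G_{2κτ} * ρ⁰)(x) = 𝔼[ρ⁰(x - proj (√(2κτ) Z))]`,
`Z ∼ N(0, I_d)` (`ProbabilityTheory.stdGaussian`). For `τ = 0` this is `ρ⁰`
(`torusHeatSolution_zero`). [cite: BodineauGallagherSaintRaymondInvent2016, (2.11)] -/
def torusHeatSolution (κ : ℝ) (ρ₀ : 𝕋 → ℝ) (τ : ℝ) (x : 𝕋) : ℝ :=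
  ∫ z, ρ₀ (x - Literature.Analysis.FunctionSpaces.Torus.proj (Real.sqrt (2 * κ * τ) • z)) ∂stdGaussian 𝔼

/-- At time `0` the heat solution is the datum. [folklore] -/
@[simp]
theorem torusHeatSolution_zero (κ : ℝ) (ρ₀ : 𝕋 → ℝ) (x : 𝕋) :
    torusHeatSolution κ ρ₀ 0 x = ρ₀ x := by
  simp [torusHeatSolution]

/-- `φ` is *the* solution of BGSR's linear Boltzmann equation (1.3) with inverse mean free path
`α`, background `M_β` and initial datum `ρ⁰(x)` (independent of `v`), in the bounded continuous
class in which the maximum principle (BGSR (4.2)) makes it unique: `φ(0, x, v) = ρ⁰(x)`; on every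
slab `[0, T]`, `φ` is continuous and bounded, and `g = M_β φ` is a mild solution of
`∂ₜ g + v·∇ₓ g = α Q(g, M_β)` with the hard-sphere kernel (the accepted
`Kinetic.IsMildLinearBoltzmannSolutionOn` with kernel `α • hardSphereKernel`), which is (1.3)
multiplied by `M_β(v)` since `M_β(v') M_β(v₁') = M_β(v) M_β(v₁)`.
[cite: BodineauGallagherSaintRaymondInvent2016, (1.3) and §2.3] -/
structure IsTaggedLinearBoltzmannSolution (β α : ℝ) (ρ₀ : 𝕋 → ℝ) (φ : ℝ → 𝕋 → 𝔼 → ℝ) :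
    Prop where
  /-- The initial datum is `ρ⁰(x)`. -/
  init : φ 0 = fun x _ => ρ₀ x
  /-- `φ` is continuous on every slab `[0, T] × T^d × ℝ^d`. -/
  continuousOn : ∀ T : ℝ, 0 ≤ T →
    ContinuousOn (fun p : ℝ × 𝕋 × 𝔼 => φ p.1 p.2.1 p.2.2) (Icc 0 T ×ˢ univ)
  /-- `φ` is bounded on every slab. -/
  bounded : ∀ T : ℝ, 0 ≤ T → ∃ C : ℝ, ∀ t ∈ Icc 0 T, ∀ x v, |φ t x v| ≤ C
  /-- `M_β φ` is a mild solution of the linear Boltzmann equation with rate `α`. -/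
  mild : ∀ T : ℝ, 0 ≤ T →
    Literature.Analysis.FunctionSpaces.IsMildLinearBoltzmannSolutionOn T (Literature.Analysis.FluidPDE.Torus.geometry d) (α • hardSphereKernel)
      (Literature.Analysis.FunctionSpaces.maxwellianBeta β) fun t x v => Literature.Analysis.FunctionSpaces.maxwellianBeta β v * φ t x v

/-! ## The printed intermediate results, as named facts -/

/-- **BGSR Theorem 2.2** (arXiv:1305.3397v2 p. 7, (2.9)), in the uniform form delivered by its
proof (Prop. 4.3 + Prop. 5.8, p. 30) and used in §6.1.1. Let `d ≥ 2`, `β > 0`, `A ≥ 2` and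
`R ≥ 0`. There are `C > 0` and `N₀` (depending on `d, β, A, R` only) such that for every
`N ≥ N₀`, every diameter `0 < ε < 1/2` with inverse mean free path
`α := (N + 1) ε^{d-1} > 1` (the paper's `N ε^{d-1} α⁻¹ = 1`, its `N` being the total number
`N + 1` of spheres here), every continuous probability density `0 ≤ ρ⁰ ≤ R` on `T^d` and every
hard-sphere flow `Φ` of the `N + 1` spheres, there is a solution `φ = φ_α` of the linear
Boltzmann equation (1.3) with datum `ρ⁰` (`IsTaggedLinearBoltzmannSolution β α ρ⁰ φ`) such that
for every `t > 1`
`‖f_N^{(1)}(t) - M_β φ_α(t)‖_{L^∞(T^d × ℝ^d)} ≤ C [t α / (log log (N+1))^{(A-1)/A}]^{A²/(A-1)}`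
(`f_N^{(1)}` = `bgsrTaggedMarginal`, essential supremum `eLpNorm · ∞`). Printed: "for all
`t > 0` and all `α > 1`, in the limit `N → ∞` …, where `A ≥ 2` can be taken arbitrarily large,
and `C` depends on `A, β, d` and `‖ρ⁰‖_{L^∞}`"; `t > 1` is the range of Prop. 4.3.
[cite: BodineauGallagherSaintRaymondInvent2016, Thm. 2.2 (2.9)] -/
def bgsr_linearBoltzmannApprox : Prop :=
  ∀ (hd : 2 ≤ Fintype.card d) {β : ℝ} (hβ : 0 < β) {A : ℝ} (hA : 2 ≤ A) {R : ℝ} (hR : 0 ≤ R),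
    ∃ C : ℝ, 0 < C ∧ ∃ N₀ : ℕ, ∀ N : ℕ, N₀ ≤ N → ∀ ε : ℝ, 0 < ε → ε < 2⁻¹ →
      1 < (N + 1 : ℝ) * ε ^ (Fintype.card d - 1) →
      ∀ ρ₀ : 𝕋 → ℝ, Continuous ρ₀ → (∀ x, 0 ≤ ρ₀ x) → (∀ x, ρ₀ x ≤ R) → ∫ x, ρ₀ x = 1 →
      ∀ Φ : Literature.Analysis.FluidPDE.HardSphereFlow (Literature.Analysis.FluidPDE.Torus.geometry d) ε (N + 1),
      ∃ φ : ℝ → 𝕋 → 𝔼 → ℝ,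
        IsTaggedLinearBoltzmannSolution β ((N + 1 : ℝ) * ε ^ (Fintype.card d - 1)) ρ₀ φ ∧
        ∀ t : ℝ, 1 < t →
          eLpNorm (fun p : 𝕋 × 𝔼 => bgsrTaggedMarginal Φ β ρ₀ t p.1 p.2 -
              Literature.Analysis.FunctionSpaces.maxwellianBeta β p.2 * φ t p.1 p.2) ∞ volume ≤
            ENNReal.ofReal (C * (t * ((N + 1 : ℝ) * ε ^ (Fintype.card d - 1)) /
              Real.log (Real.log (N + 1)) ^ ((A - 1) / A)) ^ (A ^ 2 / (A - 1)))

/-- **BGSR Lemma 6.1 with (6.5)** (arXiv:1305.3397v2 p. 31; proof after Hilbert 1912, BGSR's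
[24]): for `d ≥ 2` and `β > 0` the linear Boltzmann operator `L` is a Fredholm operator on
`L²(ℝ^d, a_β M_β dv)` whose kernel reduces to the constants, hence is invertible on the centred
functions; in particular the corrector `b = L⁻¹ v` of (6.5) exists and is unique (a.e.).
[cite: BodineauGallagherSaintRaymondInvent2016, Lemma 6.1 and (6.5)] -/
def bgsr_exists_diffusionCorrector : Prop :=
  ∀ (hd : 2 ≤ Fintype.card d) {β : ℝ} (hβ : 0 < β),
    (∃ b : 𝔼 → 𝔼, IsDiffusionCorrector β b) ∧
      ∀ b b' : 𝔼 → 𝔼, IsDiffusionCorrector β b → IsDiffusionCorrector β b' → b =ᵐ[volume] b'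

/-- **Positivity of the diffusion coefficient** `κ_β` of BGSR (6.8): for `d ≥ 2`, `β > 0` and
any corrector `b` (`L b = v`), `κ_β = d⁻¹ ∫ v·b M_β = d⁻¹ ⟨L b, b⟩_{L²(M_β)} > 0`, `L` being
symmetric nonnegative on `L²(M_β dv)` with
`⟨L g, g⟩ = ½ ∫∫∫ ((v-v₁)·ν)₊ M_β M_β |g(v) - g(v')|² > 0` for non-constant `g`; equivalently
`κ_β` is the limiting variance per unit time of the position of the Markov process with
generator `L` (BGSR §6.2 Step 2, after (6.22): "a Brownian motion of variance `κ_β`").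
[cite: BodineauGallagherSaintRaymondInvent2016, (6.8) and §6.2 Step 2] -/
def bgsr_diffusionCoeff_pos : Prop :=
  ∀ (hd : 2 ≤ Fintype.card d) {β : ℝ} (hβ : 0 < β) (b : 𝔼 → 𝔼) (hb : IsDiffusionCorrector β b),
    0 < bgsrDiffusionCoeff β b

/-- **BGSR (6.3)** (arXiv:1305.3397v2 p. 31, proved in §6.1.2–6.1.3 by the Hilbert expansion
(6.4)–(6.10) and the maximum principle; after Bensoussan–Lions–Papanicolaou, BGSR's [6]): the
diffusive limit of the linear Boltzmann equation. Let `d ≥ 2`, `β > 0`, `b` the corrector of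
(6.5) and `κ_β` the coefficient (6.8); let `ρ⁰` be a continuous probability density on `T^d`
and `T > 0`. Then `sup_{τ ∈ [0,T]} sup_{(x,v)} M_β(v) |φ_α(ατ, x, v) - ρ(τ, x)| → 0` as
`α → ∞`, where `φ_α` is the solution of (1.3) with rate `α` and datum `ρ⁰`
(`IsTaggedLinearBoltzmannSolution β α ρ⁰ φ`) and `ρ` solves `∂_τ ρ = κ_β Δ ρ`, `ρ(0) = ρ⁰`
(`torusHeatSolution κ_β ρ⁰`). Rendered with explicit `e, α₀`.
[cite: BodineauGallagherSaintRaymondInvent2016, (6.3)] -/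
def bgsr_hydrodynamicLimit : Prop :=
  ∀ (hd : 2 ≤ Fintype.card d) {β : ℝ} (hβ : 0 < β) (b : 𝔼 → 𝔼) (hb : IsDiffusionCorrector β b)
    (ρ₀ : 𝕋 → ℝ) (hρ₀ : Continuous ρ₀) (hρ₀0 : ∀ x, 0 ≤ ρ₀ x) (hρ₀1 : ∫ x, ρ₀ x = 1)
    {T : ℝ} (hT : 0 < T) {e : ℝ} (he : 0 < e),
    ∃ α₀ : ℝ, ∀ α : ℝ, α₀ ≤ α → ∀ φ : ℝ → 𝕋 → 𝔼 → ℝ,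
      IsTaggedLinearBoltzmannSolution β α ρ₀ φ →
      ∀ τ ∈ Icc 0 T, ∀ (x : 𝕋) (v : 𝔼),
        Literature.Analysis.FunctionSpaces.maxwellianBeta β v *
          |φ (α * τ) x v - torusHeatSolution (bgsrDiffusionCoeff β b) ρ₀ τ x| ≤ e

/-! ## The corrected one-time statement of Theorem 2.3 -/

/-- hilbert6.S22 (d) **corrected** (Bodineau–Gallagher–Saint-Raymond, Invent. Math. 203 (2016),
Thm 2.3 = arXiv:1305.3397v2 Thm. 2.3 with §6.1.1): verbatim
`bodineau_gallagher_saintRaymond_brownian` — `d ≥ 2`, `β > 0`, a constant `κ = κ(d, β) > 0`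
(`κ = 2κ_β`, `κ_β` of (6.8)), sequences `0 < ε_k < 1/2`, `α_k := (N_k + 1) ε_k^{d-1} → ∞`, a
continuous position density `ρ⁰ ≥ 0` of unit mass, the initial density (2.8)
(`Kinetic.equilibriumTaggedDensity … β (ρ⁰ ∘ Prod.fst)`), any hard-sphere flows, and for every
`τ > 0` weak convergence of the law of the tagged POSITION at time `α_k τ`
(`Kinetic.taggedPositionLaw`) to `ρ⁰` convolved with the wrapped Gaussian of covariance `κτ · Id`
— EXCEPT for the growth restriction on `α_k`, which is the one the printed proof supports:
for some fixed `A ≥ 2`, `α_k / (log log (N_k + 1))^{(A-1)/(2A)} → 0` (§6.1.1: the error (6.1)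
is `C(A) [α² τ / (log log N)^{(A-1)/A}]^{A²/(A-1)}`, small "as soon as
`α ≪ (log log N)^{(A-1)/(2A)}`"; the paper's `N` is the total number of spheres, `N_k + 1` here).
The vendored (d) instead assumes only `α_k / √(log log N_k) → 0`, the literal reading of the
theorem's informal "much slower than `√(log log N)`", which is strictly weaker as a hypothesis
(e.g. `α_k = √(log log N_k) / log log log N_k`) and is not covered by any printed estimate, `C`
depending on `A` in (2.9). Hence (d) implies this statement, not conversely. Junk values of
`Real.log ∘ Real.log` and `Real.rpow` at `N_k + 1 < 16` are irrelevant (`α_k → ∞` forces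
`N_k → ∞`). Process-level convergence (the second half of Thm 2.3) is not typed.
[cite: BodineauGallagherSaintRaymondInvent2016, Thm. 2.3 and §6.1.1 (6.1)] -/
def bodineau_gallagher_saintRaymond_diffusive : Prop :=
  ∀ (hd : 2 ≤ Fintype.card d) {β : ℝ} (hβ : 0 < β),
    ∃ κ > (0 : ℝ), ∀ (N : ℕ → ℕ) (ε α : ℕ → ℝ), (∀ k, 0 < ε k) → (∀ k, ε k < 2⁻¹) →
      (∀ k, α k = (N k + 1 : ℝ) * ε k ^ (Fintype.card d - 1)) → Tendsto α atTop atTop →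
      (∃ A : ℝ, 2 ≤ A ∧
        Tendsto (fun k => α k / Real.log (Real.log (N k + 1)) ^ ((A - 1) / (2 * A)))
          atTop (𝓝 0)) →
      ∀ ρ₀ : UnitAddTorus d → ℝ, Continuous ρ₀ → (∀ x, 0 ≤ ρ₀ x) → ∫ x, ρ₀ x = 1 →
      ∀ Φ : ∀ k, Literature.Analysis.FluidPDE.HardSphereFlow (Literature.Analysis.FluidPDE.Torus.geometry d) (ε k) (N k + 1),
      ∀ τ > (0 : ℝ), ∀ φ : UnitAddTorus d → ℝ, Continuous φ →
        Tendsto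
          (fun k => ∫ x, φ x ∂Literature.Analysis.FunctionSpaces.taggedPositionLaw (Φ k)
            (Literature.Analysis.FunctionSpaces.equilibriumTaggedDensity (Literature.Analysis.FluidPDE.Torus.geometry d) (ε k) (N k) β
              (fun z => ρ₀ z.1)) (α k * τ))
          atTop
          (𝓝 (∫ x, ρ₀ x * ∫ z, φ ((Literature.Analysis.FluidPDE.Torus.geometry d).translate x (Real.sqrt (κ * τ) • z))
            ∂stdGaussian 𝔼))

end

end Literature.MathematicalPhysics.KineticTheory
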